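import Summits.ResolutionOfSingularities.ResolutionOfSingularities.Theorems.PurelyInseparableDim4SpivakovskyDelta
import HarnessLib

/-!
# [OURS · res-dim4-pi I-8-1 T2] LEMMA W-T: the denominators of the flag are a function of the prefix, hence `δ` admits
  no infinite lexicographic descent

Cell `res-dim4-pi` (D-0157 DOOR 2), seat `res-dim4-p-11`; brick T2 of CARD I-8-1 (idea-8, memo `LEMMA-WT.md` 6738f69d9bcdd6c5
§§1–2; crit-1 V-A-18 (c), crit-2 V-B-24 P-B59).  Def-free sequel of `…SpivakovskyDelta`.  [OURS — idea-8's static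
replacement for the functorial (Lemma 2) step of [cite: Spivakovsky1983, §III (last paragraph, bounded denominators)]:
«§1 replaces functoriality by a static bound valid for EVERY position, so the corollary applies to any rule under which δ
drops».]

* §1 **LEMMA W-T (`den_derive`)**: if `G ⊂ (1/D)ℕ^σ` (`Den D G`) and `d(G̃) = u/D` with `u ≠ 0`, then the derived generator set
  satisfies `Den (max D u)! (derive I G)` — every entry of `P_S(h)` is `m/s` with `1 ≤ s ≤ max(D, u)` (the memo's two-case
  computation; the factorial replaces `lcm(1..max)` so that no new definition is needed).
* §2 **T2 (`no_infinite_delta_descent`)**: for fixed `N > 0` there is NO sequence of good positions `G⁽ˡ⁾` on index sets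
  `I⁽ˡ⁾` (arbitrary, varying with `l`) with `Den N (G⁽ˡ⁾)` and `δ(I⁽ˡ⁺¹⁾, G⁽ˡ⁺¹⁾) <_lex δ(I⁽ˡ⁾, G⁽ˡ⁾)` for every `l`
  (position-by-position stabilisation: heads `N·d(G̃) ∈ ℕ` antitone ⇒ stable; one-vertex tail `N·d(G)` strictly drops;
  otherwise `#I₁` stabilises, an `[∞,∞]` tail can occur at most once, and the derived positions descend with denominators
  `(max N u)!` — induction on the cardinality bound).  Consequently ANY rule along whose plays `δ` drops terminates
  (`…SpivakovskyDeltaRules`).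

[OURS · counted 0 · AI work weaker than expert review] A statement about OUR frame's spine game bookkeeping; NOTHING here is a
theorem about resolution of singularities in dimension ≥ 4 / characteristic `p`. bears_on: LADDER-RESOLUTION:D157-DOOR2
(res-dim4-pi · I-8-1 T2). Supports stmt-ResolutionOfSingularities-16155 (helper).
-/

set_option linter.dupNamespace false -- mandated namespace of this single-conjunct summit

open Finset
open scoped BigOperators

namespace Summit.ResolutionOfSingularities.ResolutionOfSingularities.Theorems.PIDim4

namespace Spivakovsky

variable {σ : Type} [Fintype σ] [DecidableEq σ]

/-! ## §1 LEMMA W-T: denominators of the derived position -/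

section WT

variable {I : Finset σ} {G : Pos σ}

/-- `d(G) ≥ 0` on a good position. [folklore] -/
theorem dG_nonneg (hgood : Good I G) (Γ : Finset σ) : 0 ≤ dG Γ G :=
  le_dG Γ hgood.1 fun g hg => Finset.sum_nonneg fun k _ => hgood.2.1 g hg k

/-- Integrality transport: if `x * s = m` with `m : ℤ`, `s : ℕ` and `s ∣ L`, then `x * L` is an integer. [folklore] -/
theorem exists_int_mul_of_dvd {x : ℚ} {s L : ℕ} {m : ℤ} (hx : x * s = m) (hdvd : s ∣ L) :
    ∃ z : ℤ, x * L = z := by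
  obtain ⟨c, hc⟩ := hdvd
  refine ⟨m * c, ?_⟩
  have : (L : ℚ) = (s : ℚ) * c := by rw [hc]; push_cast; ring
  rw [this, ← mul_assoc, hx]
  push_cast; ring

omit [Fintype σ] in
/-- The core of W-T: if every coordinate of `h` lies in `(1/E)ℤ` (`E ≥ 1`), `h ≥ 0` and `β = Σ_S h < 1`, then every
coordinate of `P_S(h)` (`= h_k/(1−β)` on `J`, `0` elsewhere) lies in `(1/M!)ℤ` for every `M ≥ E`: indeed `(1−β)E = s`
is an integer with `1 ≤ s ≤ E` and `P_S(h)_k · s = h_k · E`. [cite: Spivakovsky1983, §III (bounded denominators)] -/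
theorem exists_int_proj_mul_factorial {S J : Finset σ} {h : σ → ℚ} {E M : ℕ} (hE : 0 < E) (hEM : E ≤ M)
    (hint : ∀ j, ∃ z : ℤ, h j * E = z) (hnonneg : ∀ j, 0 ≤ h j) (hlt : ∑ j ∈ S, h j < 1) (k : σ) :
    ∃ z : ℤ, proj S J h k * (Nat.factorial M : ℕ) = z := by
  by_cases hk : k ∈ J
  · rw [proj_apply_of_mem hk]
    -- `β E` and `(1 − β) E` are integers
    choose zj hzj using hint
    have hβ : (∑ j ∈ S, h j) * E = ((∑ j ∈ S, zj j : ℤ) : ℚ) := by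
      rw [Finset.sum_mul]; push_cast; exact Finset.sum_congr rfl fun j _ => hzj j
    set sQ : ℚ := (1 - ∑ j ∈ S, h j) * E with hsQ
    have hsZ : sQ = (((E : ℤ) - ∑ j ∈ S, zj j : ℤ) : ℚ) := by
      rw [hsQ, sub_mul, one_mul, hβ]; push_cast; ring
    have hspos : 0 < sQ := by
      have hEq : (0 : ℚ) < E := by exact_mod_cast hE
      rw [hsQ]; exact mul_pos (by linarith) hEq
    have hsle : sQ ≤ E := by
      have hβ0 : 0 ≤ ∑ j ∈ S, h j := Finset.sum_nonneg fun j _ => hnonneg j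
      have hEq : (0 : ℚ) ≤ E := by exact_mod_cast hE.le
      rw [hsQ]; nlinarith
    -- the natural number `s`
    set sN : ℕ := ((E : ℤ) - ∑ j ∈ S, zj j).toNat with hsN
    have hsNQ : (sN : ℚ) = sQ := by
      have h0 : (0 : ℤ) ≤ (E : ℤ) - ∑ j ∈ S, zj j := by
        have : (0 : ℚ) < (((E : ℤ) - ∑ j ∈ S, zj j : ℤ) : ℚ) := by rw [← hsZ]; exact hspos
        exact_mod_cast this.le
      rw [hsN, hsZ]; exact_mod_cast Int.toNat_of_nonneg h0
    have hsNpos : 0 < sN := by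
      have : (0 : ℚ) < sN := by rw [hsNQ]; exact hspos
      exact_mod_cast this
    have hsNle : sN ≤ M := by
      have : (sN : ℚ) ≤ M := by rw [hsNQ]; exact hsle.trans (by exact_mod_cast hEM)
      exact_mod_cast this
    -- `P_S(h)_k · s = h_k · E`
    have hprod : h k / (1 - ∑ j ∈ S, h j) * sN = zj k := by
      rw [hsNQ, hsQ, ← hzj k]
      have hden : (1 - ∑ j ∈ S, h j) ≠ 0 := by linarith
      field_simp
    exact exists_int_mul_of_dvd hprod (Nat.dvd_factorial hsNpos hsNle)
  · rw [proj_apply_of_not_mem hk]; exact ⟨0, by simp⟩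

/-- **LEMMA W-T (idea-8, `LEMMA-WT.md` §1).**  If `G ⊂ (1/D)ℕ^σ` and `d(G̃)·D = u ≠ 0`, then every derived generator lies in
`(1/(max D u)!)ℤ^σ`: `Den (max D u)! (derive I G)`.  (Case `h = g`: entries `m/D`, `(1−β)D = s ≤ D`; case `h = g̃/d(G̃)`:
entries `m/u`, `(1−β)u = s ≤ u`.) [cite: Spivakovsky1983, §III (bounded denominators)] -/
theorem den_derive (hgood : Good I G) {D u : ℕ} (hDpos : 0 < D) (hD : Den D G) (hu : dt I G * D = u) (hu0 : u ≠ 0) :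
    Den (Nat.factorial (max D u)) (derive I G) := by
  intro y hy k
  obtain ⟨h, hH, hlt, rfl⟩ := mem_derive_iff.mp hy
  have hnonneg : ∀ j, 0 ≤ h j := fun j => Hset_nonneg hgood hH j
  rcases mem_Hset_iff.mp hH with hg | ⟨x, hx, rfl⟩
  · -- `h = g ∈ G`: denominators `D`
    exact exists_int_proj_mul_factorial hDpos (le_max_left D u) (fun j => hD h hg j) hnonneg hlt k
  · -- `h = g̃ / d(G̃)`: denominators `u`
    obtain ⟨g, hg, rfl⟩ := mem_tilde_iff.mp hx
    have hupos : 0 < u := Nat.pos_of_ne_zero hu0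
    have hint : ∀ j, ∃ z : ℤ, ((dt I G)⁻¹ • (g - omega G)) j * u = z := by
      intro j
      obtain ⟨zg, hzg⟩ := hD g hg j
      obtain ⟨zo, hzo⟩ := exists_int_omega hD hgood.1 j
      refine ⟨zg - zo, ?_⟩
      have hdtne : dt I G ≠ 0 := by
        intro h0; apply hu0
        have : (u : ℚ) = 0 := by rw [← hu, h0, zero_mul]
        exact_mod_cast this
      simp only [Pi.smul_apply, Pi.sub_apply, smul_eq_mul]
      rw [← hu]
      field_simp
      push_cast
      rw [← hzg, ← hzo]; ring
    exact exists_int_proj_mul_factorial hupos (le_max_right D u) hint hnonneg hlt k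

end WT

/-! ## §2 T2: no infinite lexicographic descent of `δ` -/

section T2

/-- Nothing is lex-below the empty list. [folklore] -/
theorem not_lex_nil {l : List (WithTop ℚ)} : ¬ List.Lex (· < ·) l [] := fun h => by cases h

/-- Unpacking a lex comparison of two non-empty lists. [folklore] -/
theorem lex_cons_cons_iff {a b : WithTop ℚ} {s t : List (WithTop ℚ)} :
    List.Lex (· < ·) (a :: s) (b :: t) ↔ a < b ∨ (a = b ∧ List.Lex (· < ·) s t) := by
  constructor
  · intro h
    cases h with
    | cons h => exact Or.inr ⟨rfl, h⟩
    | rel h => exact Or.inl h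
  · rintro (h | ⟨rfl, h⟩)
    · exact List.Lex.rel h
    · exact List.Lex.cons h

/-- `[∞, ∞]` is not lex-below itself. [folklore] -/
theorem not_lex_top_top : ¬ List.Lex (· < ·) ([⊤, ⊤] : List (WithTop ℚ)) [⊤, ⊤] := by
  intro h
  rcases lex_cons_cons_iff.mp h with h | ⟨-, h⟩
  · exact lt_irrefl _ h
  · rcases lex_cons_cons_iff.mp h with h | ⟨-, h⟩
    · exact lt_irrefl _ h
    · exact not_lex_nil h

/-- `[∞, ∞]` is not lex-below the `δ` of a good position (whose head is finite). [folklore] -/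
theorem not_lex_top_delta {I : Finset σ} {G : Pos σ} (hgood : Good I G) :
    ¬ List.Lex (· < ·) ([⊤, ⊤] : List (WithTop ℚ)) (delta I G) := by
  obtain ⟨t, ht⟩ := delta_eq_cons hgood
  rw [ht]
  intro h
  rcases lex_cons_cons_iff.mp h with h | ⟨h, -⟩
  · exact not_top_lt h
  · exact WithTop.top_ne_coe h

/-- Head comparison: a lex drop between `δ`'s of good positions makes `d(G̃)` non-increase. [folklore] -/
theorem dt_le_of_delta_lex {I I' : Finset σ} {G G' : Pos σ} (hgood : Good I G) (hgood' : Good I' G')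
    (h : List.Lex (· < ·) (delta I' G') (delta I G)) : dt I' G' ≤ dt I G := by
  obtain ⟨t, ht⟩ := delta_eq_cons hgood
  obtain ⟨t', ht'⟩ := delta_eq_cons hgood'
  rw [ht, ht'] at h
  rcases lex_cons_cons_iff.mp h with h | ⟨h, -⟩
  · exact le_of_lt (by exact_mod_cast h)
  · exact le_of_eq (by exact_mod_cast h)

/-- **T2 (idea-8's Corollary §2, generator form): no infinite `δ`-descent under bounded denominators.**  For every bound
`n` on the index sets and every `N > 0` there is no sequence of good positions `G l` on index sets `I l` (`#(I l) ≤ n`)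
with `Den N (G l)` and `δ(I (l+1), G (l+1)) <_lex δ(I l, G l)` for all `l`.
[cite: Spivakovsky1983, §III (termination: «δ(Δ) cannot decrease forever»)] -/
theorem no_infinite_delta_descent : ∀ (n N : ℕ), 0 < N → ∀ (I : ℕ → Finset σ) (G : ℕ → Pos σ),
    (∀ l, (I l).card ≤ n) → (∀ l, Good (I l) (G l)) → (∀ l, Den N (G l)) →
      (∀ l, List.Lex (· < ·) (delta (I (l + 1)) (G (l + 1))) (delta (I l) (G l))) → False := by
  intro n
  induction n with
  | zero =>
    -- `I l = ∅`: then `d_∅(G̃) = 0` and `δ = [0, d_∅(G)] = [0, 0]` is constant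
    intro N _ I G hI hgood _ hlex
    have hI0 : ∀ l, I l = ∅ := fun l => Finset.card_eq_zero.mp (Nat.le_zero.mp (hI l))
    have hdG : ∀ l (X : Pos σ), X.Nonempty → dG (I l) X = 0 := fun l X hX => by
      obtain ⟨g, hg, hgd⟩ := exists_dG_eq (I l) hX
      rw [← hgd, hI0 l, Finset.sum_empty]
    have hδ : ∀ l, delta (I l) (G l) = [0, 0] := fun l => by
      have hdt : dt (I l) (G l) = 0 := hdG l _ (tilde_nonempty (hgood l).1)
      rw [delta_of_dt_eq_zero (hgood l).1 hdt, hdG l _ (hgood l).1]; rfl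
    have h := hlex 0
    rw [hδ, hδ] at h
    rcases lex_cons_cons_iff.mp h with h | ⟨-, h⟩
    · exact lt_irrefl _ h
    · rcases lex_cons_cons_iff.mp h with h | ⟨-, h⟩
      · exact lt_irrefl _ h
      · exact not_lex_nil h
  | succ n ih =>
    intro N hN I G hI hgood hden hlex
    -- (1) heads `N · d(G̃) ∈ ℕ` are antitone, hence eventually constant
    have hnat : ∀ l, ∃ m : ℕ, dt (I l) (G l) * N = m := fun l => exists_nat_dt (hgood l) (hden l)
    choose f hf using hnat
    have hNq : (0 : ℚ) < N := by exact_mod_cast hN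
    have hmono : ∀ l, dt (I (l + 1)) (G (l + 1)) ≤ dt (I l) (G l) := fun l =>
      dt_le_of_delta_lex (hgood l) (hgood (l + 1)) (hlex l)
    have hfmono : ∀ l, f (l + 1) ≤ f l := fun l => by
      have : (f (l + 1) : ℚ) ≤ f l := by
        rw [← hf, ← hf]; exact mul_le_mul_of_nonneg_right (hmono l) hNq.le
      exact_mod_cast this
    obtain ⟨l₀, hl₀⟩ := exists_stable_of_antitone hfmono
    have hconst : ∀ l, l₀ ≤ l → dt (I l) (G l) = dt (I l₀) (G l₀) := fun l hl => by
      have h1 : dt (I l) (G l) * N = dt (I l₀) (G l₀) * N := by rw [hf, hf, hl₀ l hl]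
      exact mul_right_cancel₀ hNq.ne' h1
    set c := dt (I l₀) (G l₀) with hc
    by_cases hc0 : c = 0
    · -- (2) one-vertex tail from `l₀` on: `δ = [0, d(G)]`, so `N · d(G) ∈ ℕ` drops strictly for ever — impossible
      have hδ : ∀ l, l₀ ≤ l → delta (I l) (G l) = [0, ((dG (I l) (G l) : ℚ) : WithTop ℚ)] := fun l hl =>
        delta_of_dt_eq_zero (hgood l).1 (by rw [hconst l hl, hc0])
      have hdrop : ∀ l, l₀ ≤ l → dG (I (l + 1)) (G (l + 1)) < dG (I l) (G l) := fun l hl => by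
        have h := hlex l
        rw [hδ l hl, hδ (l + 1) (by omega)] at h
        rcases lex_cons_cons_iff.mp h with h | ⟨-, h⟩
        · exact absurd h (lt_irrefl _)
        · rcases lex_cons_cons_iff.mp h with h | ⟨-, h⟩
          · exact_mod_cast h
          · exact absurd h not_lex_nil
      have hz : ∀ m, ∃ z : ℤ, dG (I (l₀ + m)) (G (l₀ + m)) * N = z := fun m =>
        exists_int_dG (hden _) (hgood _).1 _
      choose z hz using hz
      have hzdrop : ∀ m, z (m + 1) < z m := fun m => by
        have hlt := hdrop (l₀ + m) (by omega)
        have : (z (m + 1) : ℚ) < z m := by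
          rw [← hz m, ← hz (m + 1), ← add_assoc]
          exact mul_lt_mul_of_pos_right hlt hNq
        exact_mod_cast this
      have hzfloor : ∀ m, (0 : ℤ) ≤ z m := fun m => by
        have : (0 : ℚ) ≤ z m := by
          rw [← hz m]; exact mul_nonneg (dG_nonneg (hgood _) _) hNq.le
        exact_mod_cast this
      have hbound : ∀ m, z m ≤ z 0 - m := fun m => by
        induction m with
        | zero => simp
        | succ m ihm => have := hzdrop m; push_cast; omega
      have h1 := hbound ((z 0).toNat + 1)
      have h2 := hzfloor ((z 0).toNat + 1)
      push_cast at h1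
      omega
    · -- (3) `d(G̃) = c ≠ 0` from `l₀` on: `δ = c :: #I₁ :: δ(I₁, G₁)`
      have hdt : ∀ l, l₀ ≤ l → dt (I l) (G l) ≠ 0 := fun l hl => by rw [hconst l hl]; exact hc0
      have hδ : ∀ l, l₀ ≤ l → delta (I l) (G l) =
          ((c : ℚ) : WithTop ℚ) :: (((I1 (I l) (G l)).card : ℚ) : WithTop ℚ) ::
            delta (I1 (I l) (G l)) (derive (I l) (G l)) := fun l hl => by
        rw [delta_of_dt_ne_zero (hgood l) (hdt l hl), hconst l hl]
      -- the second entries are antitone naturals from `l₀` on, the third components lex-drop when they agree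
      have hstep : ∀ l, l₀ ≤ l →
          (I1 (I (l + 1)) (G (l + 1))).card < (I1 (I l) (G l)).card ∨
            ((I1 (I (l + 1)) (G (l + 1))).card = (I1 (I l) (G l)).card ∧
              List.Lex (· < ·) (delta (I1 (I (l + 1)) (G (l + 1))) (derive (I (l + 1)) (G (l + 1))))
                (delta (I1 (I l) (G l)) (derive (I l) (G l)))) := fun l hl => by
        have h := hlex l
        rw [hδ l hl, hδ (l + 1) (by omega)] at h
        rcases lex_cons_cons_iff.mp h with h | ⟨-, h⟩
        · exact absurd h (lt_irrefl _)
        · rcases lex_cons_cons_iff.mp h with h | ⟨h, h'⟩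
          · exact Or.inl (by exact_mod_cast h)
          · exact Or.inr ⟨by exact_mod_cast h, h'⟩
      have hgmono : ∀ m, (I1 (I (l₀ + m + 1)) (G (l₀ + m + 1))).card ≤ (I1 (I (l₀ + m)) (G (l₀ + m))).card :=
        fun m => by
        rcases hstep (l₀ + m) (by omega) with h | ⟨h, -⟩
        · exact h.le
        · exact h.le
      obtain ⟨m₀, hm₀⟩ := exists_stable_of_antitone (f := fun m => (I1 (I (l₀ + m)) (G (l₀ + m))).card)
        (fun m => by simpa [add_assoc] using hgmono m)
      set l₁ := l₀ + m₀ with hl₁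
      have hcard : ∀ m, (I1 (I (l₁ + m)) (G (l₁ + m))).card = (I1 (I l₁) (G l₁)).card := fun m => by
        have := hm₀ (m₀ + m) (by omega)
        simpa [hl₁, add_assoc] using this
      have htail : ∀ m, List.Lex (· < ·) (delta (I1 (I (l₁ + m + 1)) (G (l₁ + m + 1))) (derive (I (l₁ + m + 1)) (G (l₁ + m + 1))))
          (delta (I1 (I (l₁ + m)) (G (l₁ + m))) (derive (I (l₁ + m)) (G (l₁ + m)))) := fun m => by
        rcases hstep (l₁ + m) (by omega) with h | ⟨-, h⟩
        · exfalso
          have := hcard (m + 1)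
          rw [show l₁ + (m + 1) = l₁ + m + 1 by omega] at this
          rw [this, hcard m] at h
          exact lt_irrefl _ h
        · exact h
      -- the derived positions are non-empty from `l₁ + 1` on (an `[∞,∞]` tail cannot drop further)
      have hne : ∀ m, (derive (I (l₁ + m + 1)) (G (l₁ + m + 1))).Nonempty := fun m => by
        by_contra hempty
        rw [Finset.not_nonempty_iff_eq_empty] at hempty
        have h := htail m
        rw [hempty, delta_empty] at h
        rcases (derive (I (l₁ + m)) (G (l₁ + m))).eq_empty_or_nonempty with h0 | h0
        · rw [h0, delta_empty] at h; exact not_lex_top_top h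
        · exact not_lex_top_delta (good_derive (hgood _) h0) h
      -- denominators of the derived play: `(max N u)!` with `u = N c` (W-T)
      have hu0 : f l₀ ≠ 0 := by
        intro h0
        apply hc0
        have : dt (I l₀) (G l₀) * N = 0 := by rw [hf]; exact_mod_cast h0
        rcases mul_eq_zero.mp this with h | h
        · exact h
        · exact absurd h hNq.ne'
      have hdenD : ∀ m, Den (Nat.factorial (max N (f l₀))) (derive (I (l₁ + m + 1)) (G (l₁ + m + 1))) := fun m =>
        den_derive (hgood _) hN (hden _) (by rw [hconst _ (by omega)]; exact hf l₀) hu0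
      -- induction hypothesis on the derived sequence (index sets of cardinality ≤ n)
      refine ih (Nat.factorial (max N (f l₀))) (Nat.factorial_pos _)
        (fun m => I1 (I (l₁ + m + 1)) (G (l₁ + m + 1))) (fun m => derive (I (l₁ + m + 1)) (G (l₁ + m + 1)))
        (fun m => ?_) (fun m => good_derive (hgood _) (hne m)) hdenD (fun m => ?_)
      · have hlt := card_I1_lt (hgood (l₁ + m + 1)) (hdt _ (by omega))
        have := hI (l₁ + m + 1)
        omega
      · have := htail (m + 1)
        simpa [add_assoc] using this

end T2

end Spivakovsky

end Summit.ResolutionOfSingularities.ResolutionOfSingularities.Theorems.PIDim4
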